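import Mathlib
import HarnessLib
import Summits.HubbardSuperconductivity.HubbardSuperconductivity.Theorems.ComplexGFFStiffnessHypACumulantTunedRepresentation
import Summits.HubbardSuperconductivity.HubbardSuperconductivity.Theorems.ComplexGFFStiffnessHypALocalTwoPointTunedSystem
import Literature.Dynamics.Hyperbolic.RGFlowStableManifoldFreeEnergyDifferences
import Literature.MathematicalPhysics.StatisticalMechanics.ActivityNormClosed
import Summits.HubbardSuperconductivity.HubbardSuperconductivity.Theorems.ComplexGFFStiffnessHypALocalTwoPointInitActFamily

/-!
# Crux `HypALocalTwoPoint`, line `gnv` — the SIX DIFFERENCE SIZES of the free-energy representation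
# for the torus data (census F1 (iii-b): the concrete four-system assembly)

Route `route-HubbardSuperconductivity-ComplexGFFStiffness`, crux item stmt-HubbardSuperconductivity-19155,
registered stub `stub_twoPointGivenZ` (⇐ `FreeEnergyBounds`, p817758).  [ABKM19] Theorem 2.2 (smoothness
half, `ℓ ≤ 2`) in difference form reads the `C^{1,1}` bounds of the free energy
`f = log κ_{𝟙,𝟙+q(ℋ)} + |Λ|λ(ℋ) + Log I` off six numbers (`…FreeEnergyPieces`): first and mixed second
differences of the tuned seeds `ℋ_{ij} = ℋ(𝒦 + iU + jV)` and of the last-scale functionals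
`Φ(ℋ_{ij}, K_N^{ij})`.  The abstract assembly `RGFlow.freeEnergySizes_of_isTunedQ`
(`Literature/Dynamics/Hyperbolic/RGFlowStableManifoldFreeEnergyDifferences`) produces them from
hypotheses on the `h`-indexed system; here it is INSTANTIATED for the concrete system of [ABKM19] Ch. 12
on the torus (`rgA`, `rgBT`, `rgSQ` at the kernels `𝒞_{𝟙+q(x₀)}`, `initAct`, `activityNormLE`,
`hamTuningMap ρ`, `Φ(x₀, y) = ∫ y(Λ) dμ_{N+1}^{(q(x₀))}`), discharging from the tree every hypothesis it
controls `N`-uniformly: the predicates (`ActivityNormClosed`, `…TunedSystem`), Theorem 6.8 (`hT`), the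
initial activities (Lemma 12.2 and its second-order versions: `activityNormLE_initAct_sub`,
`activityNormLE_initAct_sub_pert`, `activityNormLE_initAct_jointSecondDiff_bilinear`), and the `K_N`-slot
of `Φ` (`…TunedSystem`).

* **`freeEnergySizes_of_package`** — the six sizes, GIVEN (as hypotheses in the abstract interface,
  census F4/F5 of FREEENERGY-PLAN-cgffstiff2-g1 §3): the `N`-uniform `q`-Lipschitz / second-difference
  sizes of `(A_k, B_k, S_k)` ((12.51)–(12.53) and their second-order versions), the parallelogram second
  differences of `S_k` in the state, the `q`-slot of `Φ` (Lemma 8.4 at the last scale), and the smallness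
  (12.54)–(12.56).

Honest scope: a conditional assembly — nothing here proves F4/F5; no `sorry`, no new named fact.

## References
* S. Adams, S. Buchholz, R. Kotecký, S. Müller, arXiv:1910.13564, Theorem 2.2, Ch. 4 (4.7)–(4.12),
  Ch. 12, Lemma 12.2, Lemma 12.6, Theorem 12.1 [AdamsBuchholzKoteckyMuller2019].
-/



noncomputable section

-- `Summit.<Summit>.<Problem>`: single-conjunct summit, the duplicate component is mandated (D-0017).
set_option linter.dupNamespace false

namespace Summit.HubbardSuperconductivity.HubbardSuperconductivity.Theorems.ComplexGFF

open scoped BigOperators ComplexConjugate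
open Real Set Finset MeasureTheory
open Literature.MathematicalPhysics.StatisticalMechanics.GradientRG
open Literature.MathematicalPhysics.StatisticalMechanics.GradientFRD
  (fourierCoeff cExt cExt_of_mem IsElliptic IsUnitSymm InShell iterDiff supNorm conv ellOp isElliptic_one)
open Literature.MathematicalPhysics.StatisticalMechanics.TorusPolymer
  (IsPolymer numBlocks blockOf boxCorner isPolymer_blockOf isConn_blockOf pcirc)
open Literature.Barriers.CriticalPhenomena.LongRangePhi4.Polymer (IsConn components)
open Literature.MathematicalPhysics.QuantumFieldTheory
open Literature.Dynamics.Hyperbolic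

variable {d M : ℕ} [NeZero M]

section Package

variable {L N Mord R n ñ : ℕ} {θbar lam μ δ₁ δ₀ A𝒫 : ℝ}
    {𝒞 : Matrix (Fin d) (Fin d) ℝ → ℕ → (Fin d → ZMod M) → ℝ} {Mc : ℕ → ℝ}
    {Cα : (Fin d → ℕ) → ℕ → ℝ} {c C : ℝ} {Cℓ : ℕ → ℝ}

set_option maxHeartbeats 3200000 in
/-- **The six difference sizes of the free-energy representation for the torus data** ([ABKM19]
Theorem 2.2, `ℓ ≤ 2`, difference form, `ι`-symmetric complex class; census F1 (iii-b)): under the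
[ABKM19] package at fixed `(L, N)`, for a perturbation `𝒦` with increments `U`, `V` (sizes `ρ𝒦`, `u₁`,
`u₂` in the `E_{1/2}`-weighted `C^{r₀}` sense), four tuned seeds `x₀ i j` carrying tuned trajectories of
the systems of `Kf i j ∈ {𝒦, 𝒦+U, 𝒦+V, 𝒦+U+V}` in the `ε`-tube (the system `(Asys, Bsys, Ssys)` =
`(rgA, rgBT, rgSQ)` at the kernels `𝒞_{𝟙+q(x₀)}`, `q = hamTuningMap ρ`, and the last-scale functional
`Φ(x₀, y) = ∫ y(Λ) dμ_{N+1}^{(q(x₀))}`, all fixed by their defining equations), and GIVEN the `N`-uniform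
`q`-regularity of the steps and of `Φ` (`ha`…`hΦ22` — the census entries F4/F5 as hypotheses in the
interface of `RGFlow.freeEnergySizes_of_isTunedQ`) with the smallness `hsmallF` of (12.54)–(12.56):
the seeds' first differences are `≤ T_i = 2μ_i/(1−κ)`, `μ_i = e^{1/4}e^{𝔥₀}A·δ_i`, their mixed second
difference is `≤ T₁₂ = 2·Rest/(1−κ)`, and the last-scale functionals `Φ(x₀ i j, y_N^{ij})` have first
differences `≤ (A⁻¹A_𝒫 + l_I ε)T_iη^N` and mixed second difference
`≤ (A⁻¹A_𝒫·T₁₂ + 2l_I'T₁T₂ + (l_I T₁₂ + l_II T₁T₂)ε)η^N` — the inputs of `…FreeEnergyPieces`. -/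
theorem freeEnergySizes_of_package {h : ℝ} [Fact (0 < h)] [Fact (0 < L)]
    (hd : 3 ≤ d) (hMord : 1 ≤ Mord) (hMR : Mord ≤ R) (hLodd : Odd L) (hL : 2 ^ (d + 3) + 16 * R ≤ L)
    (hR2 : 2 ≤ R) (hM : M = L ^ N)
    (hθbar : 0 < θbar) (hlam : 0 < lam) (hn : 2 * Mord ≤ n) (hn2 : 2 ≤ n) (hnñ : n ≤ ñ)
    (hc : 0 < c) (hC1 : 0 ≤ Cℓ 1)
    (hallA : ∀ A : Matrix (Fin d) (Fin d) ℝ, IsElliptic (1 / 2 : ℝ) 2 A →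
        (∀ k, 1 ≤ k → k ≤ N + 1 →
          ∑ x : Fin d → ZMod M, 𝒞 A k x = 0 ∧ ∀ x, 𝒞 A k (-x) = 𝒞 A k x) ∧
        (∀ k, 1 ≤ k → k ≤ N + 1 → ∀ φ : (Fin d → ZMod M) → ℝ, ∑ x, φ x = 0 →
          0 ≤ ∑ x, ∑ y, φ x * 𝒞 A k (x - y) * φ y) ∧
        (∀ φ : (Fin d → ZMod M) → ℝ, ∑ x, φ x = 0 →
          ellOp A (conv (fun x => ∑ k ∈ Finset.Icc 1 (N + 1), 𝒞 A k x) φ) = φ) ∧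
        (∀ k, 1 ≤ k → k ≤ N → Mc k ≤ 0 ∧
          ∀ x : Fin d → ZMod M, ((L : ℝ) ^ k) / 2 ≤ (supNorm x : ℝ) →
            𝒞 A k x = Mc k) ∧
        (∀ k, 1 ≤ k → k ≤ N + 1 → ∀ B : Matrix (Fin d) (Fin d) ℝ, IsUnitSymm B →
          (∃ ε : ℝ, 0 < ε ∧ ∀ x : Fin d → ZMod M,
            ContDiffOn ℝ ⊤ (fun s : ℝ => 𝒞 (A + s • B) k x) (Set.Ioo (-ε) ε)) ∧
          ∀ α : Fin d → ℕ, ∑ i, α i ≤ n → ∀ ℓ : ℕ, ∀ x : Fin d → ZMod M,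
            abs (iteratedDeriv ℓ (fun s : ℝ => iterDiff α (𝒞 (A + s • B) k) x) 0)
              ≤ Cα α ℓ / (L : ℝ) ^ ((k - 1) * (d - 2 + ∑ i, α i))) ∧
        (∀ k, 1 ≤ k → k ≤ N + 1 → ∀ j : ℕ, ∀ κ : Fin d → ZMod M, κ ≠ 0 → InShell L j κ →
          (j < k →
            c / (L : ℝ) ^ (2 * (d + ñ) + 1) * (L : ℝ) ^ (2 * j)
                / (L : ℝ) ^ ((k - j) * (d - 1 + n)) ≤ (fourierCoeff (𝒞 A k) κ).re ∧
            ‖fourierCoeff (𝒞 A k) κ‖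
              ≤ C * (L : ℝ) ^ (2 * (d + ñ) + 1) * (L : ℝ) ^ (2 * j)
                  / (L : ℝ) ^ ((k - j) * (d - 1 + n))) ∧
          (k ≤ j →
            c / (L : ℝ) ^ (2 * (d + ñ) + 1) * (L : ℝ) ^ (2 * k)
                ≤ (fourierCoeff (𝒞 A k) κ).re ∧
            ‖fourierCoeff (𝒞 A k) κ‖ ≤ C * (L : ℝ) ^ (2 * k)) ∧
          ∀ B : Matrix (Fin d) (Fin d) ℝ, IsUnitSymm B → ∀ ℓ : ℕ, 1 ≤ ℓ →
            (j < k →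
              ‖iteratedDeriv ℓ (fun s : ℝ => fourierCoeff (𝒞 (A + s • B) k) κ) 0‖
                ≤ Cℓ ℓ * (L : ℝ) ^ (2 * (d + ñ) + 1) * (L : ℝ) ^ (2 * j)
                    / (L : ℝ) ^ ((k - j) * (d - 1 + ñ))) ∧
            (k ≤ j →
              ‖iteratedDeriv ℓ (fun s : ℝ => fourierCoeff (𝒞 (A + s • B) k) κ) 0‖
                ≤ Cℓ ℓ * (L : ℝ) ^ (2 * k))))
    (hB : AbkmWeightBounds L N Mord R n θbar lam μ δ₁ δ₀ A𝒫 (fun j => 𝒞 1 j)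
      (abkmWeightData L N Mord R θbar (schedDelta δ₀ δ₁ N) fun j => 𝒞 1 j))
    {pT r₀ : ℕ} (hp : d / 2 + 2 ≤ pT) (hpM : pT + d ≤ Mord) (hr₀ : 3 ≤ r₀)
    (hδ₀ : 0 < δ₀) (hδ₁ : 0 < δ₁) (hh0 : hZeroSq d R δ₀ δ₁ ≤ h ^ 2)
    (hh2 : secondDiffConst (fun θ' => Cα θ' 0) ≤ h ^ 2)
    -- the tuning ball
    {θ : ℝ} (hθ0 : 0 ≤ θ) (hθ : θ < θbar)
    {T₀ : ℝ} (hT₀ : T₀ ≤ 1 / 2) (hKT₀ : shellRatioConst c (Cℓ 1) (L : ℝ) d ñ * T₀ ≤ Real.log (1 + θ))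
    {A𝒫' : ℝ} (hA𝒫' : weightIntConstRho θbar θ (traceConst d Mord R lam (derivSum d n fun θ' _ => Cα θ' 0)) = A𝒫')
    -- the side conditions of Theorem 6.8 (`RGStepABKMQ`), at `A_𝒫' = A_𝒫(θ)`
    {A : ℝ} (hA1 : 1 ≤ A) (hA𝒫A : A𝒫' ≤ A)
    (hsmall : (2 : ℝ) ^ (L ^ d) * (A𝒫' * A ^ (-(1 - (1 + 1 / ((2 * (2 ^ d + 1) + 6 : ℝ) ^ d))⁻¹) : ℝ)) ≤ 1)
    {r : ℝ} (hr0 : 0 ≤ r) (hr : r ≤ 1 / 64)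
    (hv : vABKM d R A A𝒫' r ≤ 1 / 64) (hωA : omegaABKM d R A A𝒫' r * A ^ 2 ≤ 1)
    (hc3A : (kappaABKM d R A A𝒫' r) ^ (L ^ d) * ((2 * (2 * (kappaABKM d R A A𝒫' r) * max 1 A𝒫')) ^ ((2 ^ (d + 1) + 2) ^ d * L ^ d) * (4 : ℝ) ^ ((2 ^ (d + 1) + 2) ^ d * L ^ d)) ≤ A ^ ((1 + 1 / ((2 * (2 ^ d + 1) + 6 : ℝ) ^ d)) - 1 : ℝ))
    (hc2A : (kappaABKM d R A A𝒫' r) ^ (L ^ d) * ((2 * (kappaABKM d R A A𝒫' r) * max 1 A𝒫') ^ ((2 ^ (d + 1) + 2) ^ d * L ^ d) * (2 : ℝ) ^ ((2 ^ (d + 1) + 2) ^ d * L ^ d)) ≤ A ^ ((1 + 1 / ((2 * (2 ^ d + 1) + 6 : ℝ) ^ d)) - 1 : ℝ))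
    -- the contraction regime of Ch. 12
    {η κ ε ρ : ℝ} (hη : 0 < η) (hη1 : η ≤ 1)
    (hκ₁ : (3 / 4 : ℝ) * (η + (L : ℝ) ^ d * (pi2BoundConst d (((2 * R + 2 : ℕ) : ℝ) + ((d / 2 + 1 : ℕ) : ℝ)) * (A𝒫' * A⁻¹))) ≤ κ)
    (hκ₂ : sigmaABKM d L R A A𝒫' r ≤ κ * η) (hκ : κ < 1)
    (hε : 0 ≤ ε) (hεr : 3 * ε ≤ r) (hερ : 3 * ε ≤ ρ) (hρ64 : ρ ≤ 1 / 64)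

    (hqT₀ : 2 * (d : ℝ) ^ 2 / (((L ^ (d * 0) : ℕ) : ℝ) * (fieldWt h (L : ℝ) d 0 / (L : ℝ) ^ 0) ^ 2) * ρ ≤ T₀)
    -- the perturbation and its two increments
    {𝒦 U V : (Fin d → ℝ) → ℂ} {ρ𝒦 u₁ u₂ : ℝ} (h𝒦 : ContDiff ℝ r₀ 𝒦) (hU : ContDiff ℝ r₀ U) (hV : ContDiff ℝ r₀ V)
    (h𝒦b : ∀ s, s ≤ r₀ → ∀ z : Fin d → ℝ, ‖iteratedFDeriv ℝ s 𝒦 z‖ ≤ ρ𝒦 * Real.exp ((∑ i, z i ^ 2) / 4))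
    (h𝒦Ub : ∀ s, s ≤ r₀ → ∀ z : Fin d → ℝ,
      ‖iteratedFDeriv ℝ s (fun z => 𝒦 z + U z) z‖ ≤ ρ𝒦 * Real.exp ((∑ i, z i ^ 2) / 4))
    (h𝒦Vb : ∀ s, s ≤ r₀ → ∀ z : Fin d → ℝ,
      ‖iteratedFDeriv ℝ s (fun z => 𝒦 z + V z) z‖ ≤ ρ𝒦 * Real.exp ((∑ i, z i ^ 2) / 4))
    (h𝒦UVb : ∀ s, s ≤ r₀ → ∀ z : Fin d → ℝ,
      ‖iteratedFDeriv ℝ s (fun z => 𝒦 z + U z + V z) z‖ ≤ ρ𝒦 * Real.exp ((∑ i, z i ^ 2) / 4))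
    (hUb : ∀ s, s ≤ r₀ → ∀ z : Fin d → ℝ, ‖iteratedFDeriv ℝ s U z‖ ≤ u₁ * Real.exp ((∑ i, z i ^ 2) / 4))
    (hVb : ∀ s, s ≤ r₀ → ∀ z : Fin d → ℝ, ‖iteratedFDeriv ℝ s V z‖ ≤ u₂ * Real.exp ((∑ i, z i ^ 2) / 4))
    (hu₁ : 0 ≤ u₁) (hu₂ : 0 ≤ u₂)
    (h𝒦small : (Real.exp (1 / 4) + 2 * Real.exp (3 / 8)) * (ρ𝒦 * Real.exp (fieldWt h (L : ℝ) d 0 / (L : ℝ) ^ 0)) * A ≤ 1 / 2)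
    (hpert : (Real.exp (1 / 4) + 16 * Real.exp (3 / 8) * (2 * ρ) + 16 * Real.exp (3 / 8) * (2 * ρ)
        + 256 * Real.exp (1 / 4) * (2 * ρ) * (2 * ρ)) * ((ρ𝒦 + u₁ + u₂) * Real.exp (fieldWt h (L : ℝ) d 0 / (L : ℝ) ^ 0)) * A ≤ 1 / 2)
    (Kf : Bool → Bool → (Fin d → ℝ) → ℂ) (hKtt : Kf true true = fun w => 𝒦 w + U w + V w)
    (hKtf : Kf true false = fun w => 𝒦 w + U w) (hKft : Kf false true = fun w => 𝒦 w + V w)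
    (hKff : Kf false false = 𝒦)
    -- the `h`-indexed system (abbreviations fixed by their defining equations)
    (Asys : (fun k => HamSpace ℂ d (fieldWt h (L : ℝ) d k) ((L : ℝ) ^ k) (L ^ (d * k))) 0 → (k : ℕ) → ((fun k => HamSpace ℂ d (fieldWt h (L : ℝ) d k) ((L : ℝ) ^ k) (L ^ (d * k))) k ≃L[ℝ] (fun k => HamSpace ℂ d (fieldWt h (L : ℝ) d k) ((L : ℝ) ^ k) (L ^ (d * k))) (k + 1)))
    (hAsys : Asys = fun h₀ => rgA L h (fun j => 𝒞 ((1 : Matrix (Fin d) (Fin d) ℝ) + hamTuningMap ρ h₀) j))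
    (Bsys : (fun k => HamSpace ℂ d (fieldWt h (L : ℝ) d k) ((L : ℝ) ^ k) (L ^ (d * k))) 0 → (k : ℕ) → ((fun k => activitySpace (abkmNormParams L N Mord R pT r₀ h θbar A (schedDelta δ₀ δ₁ N) fun j => 𝒞 1 j) k) k →+ (fun k => HamSpace ℂ d (fieldWt h (L : ℝ) d k) ((L : ℝ) ^ k) (L ^ (d * k))) (k + 1)))
    (hBsys : Eq Bsys fun h₀ =>
      rgBT hd hMord hMR hLodd hL hM hθbar hlam hn hn2 hnñ hc hC1 hallA hB pT r₀ hr₀ A hθ0 hθ hT₀ hKT₀ (hamTuningMap ρ h₀))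
    (Ssys : (fun k => HamSpace ℂ d (fieldWt h (L : ℝ) d k) ((L : ℝ) ^ k) (L ^ (d * k))) 0 → (k : ℕ) → (fun k => HamSpace ℂ d (fieldWt h (L : ℝ) d k) ((L : ℝ) ^ k) (L ^ (d * k))) k → (fun k => activitySpace (abkmNormParams L N Mord R pT r₀ h θbar A (schedDelta δ₀ δ₁ N) fun j => 𝒞 1 j) k) k → (fun k => activitySpace (abkmNormParams L N Mord R pT r₀ h θbar A (schedDelta δ₀ δ₁ N) fun j => 𝒞 1 j) k) (k + 1))
    (hSsys : Ssys = fun h₀ =>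
      rgSQ (L := L) (N := N) (Mord := Mord) (R := R) (p := pT) (r₀ := r₀) (h := h) (θbar := θbar) (A := A)
            (δ₀ := δ₀) (δ₁ := δ₁) (𝒞 := fun j => 𝒞 1 j) (fun j => 𝒞 ((1 : Matrix (Fin d) (Fin d) ℝ) + hamTuningMap ρ h₀) j))
    (Φ : (fun k => HamSpace ℂ d (fieldWt h (L : ℝ) d k) ((L : ℝ) ^ k) (L ^ (d * k))) 0 → (fun k => activitySpace (abkmNormParams L N Mord R pT r₀ h θbar A (schedDelta δ₀ δ₁ N) fun j => 𝒞 1 j) k) N → ℂ)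
    (hΦ : Φ = fun h₀ yN =>
      (∫ φ, ((yN : activitySpace (abkmNormParams L N Mord R pT r₀ h θbar A (schedDelta δ₀ δ₁ N) fun j => 𝒞 1 j) N) : Finset (Fin d → ZMod M) → ((Fin d → ZMod M) → ℝ) → ℂ) Finset.univ φ
            ∂(stepMeasure (𝒞 ((1 : Matrix (Fin d) (Fin d) ℝ) + hamTuningMap ρ h₀) (N + 1)))))
    -- the `q`-regularity of the steps and of the last-scale functional (census F4/F5), `N`-uniform constants
    {a₀ b₀ l₀ a₀₀ b₀₀ l₀₀ l₀' σ₂ lI lI' lII : ℝ} (ha0 : 0 ≤ a₀) (hb0 : 0 ≤ b₀) (hl0 : 0 ≤ l₀) (ha00 : 0 ≤ a₀₀)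
    (hb00 : 0 ≤ b₀₀) (hl00 : 0 ≤ l₀₀) (hl0' : 0 ≤ l₀') (hσ₂0 : 0 ≤ σ₂) (hlI : 0 ≤ lI) (hlI' : 0 ≤ lI') (hlII : 0 ≤ lII)
    (ha : ∀ h₀ h₀' : HamSpace ℂ d (fieldWt h (L : ℝ) d 0) ((L : ℝ) ^ 0) (L ^ (d * 0)), ‖h₀‖ ≤ ρ → ‖h₀'‖ ≤ ρ → ∀ k, k < N →
      ∀ w : HamSpace ℂ d (fieldWt h (L : ℝ) d (k + 1)) ((L : ℝ) ^ (k + 1)) (L ^ (d * (k + 1))),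
        ‖(Asys h₀ k).symm w - (Asys h₀' k).symm w‖ ≤ a₀ * ‖h₀ - h₀'‖ * ‖w‖)
    (hb : ∀ h₀ h₀' : HamSpace ℂ d (fieldWt h (L : ℝ) d 0) ((L : ℝ) ^ 0) (L ^ (d * 0)), ‖h₀‖ ≤ ρ → ‖h₀'‖ ≤ ρ → ∀ k, k < N →
      ∀ (v : activitySpace (abkmNormParams L N Mord R pT r₀ h θbar A (schedDelta δ₀ δ₁ N) fun j => 𝒞 1 j) k) (cv : ℝ), activityNormLE (abkmNormParams L N Mord R pT r₀ h θbar A (schedDelta δ₀ δ₁ N) fun j => 𝒞 1 j) k v cv →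
        ‖Bsys h₀ k v - Bsys h₀' k v‖ ≤ b₀ * ‖h₀ - h₀'‖ * cv)
    (hl : ∀ h₀ h₀' : HamSpace ℂ d (fieldWt h (L : ℝ) d 0) ((L : ℝ) ^ 0) (L ^ (d * 0)), ‖h₀‖ ≤ ρ → ‖h₀'‖ ≤ ρ → ∀ k, k < N →
      ∀ (u : HamSpace ℂ d (fieldWt h (L : ℝ) d k) ((L : ℝ) ^ k) (L ^ (d * k))) (v : activitySpace (abkmNormParams L N Mord R pT r₀ h θbar A (schedDelta δ₀ δ₁ N) fun j => 𝒞 1 j) k) (cv : ℝ), ‖u‖ ≤ r → activityNormLE (abkmNormParams L N Mord R pT r₀ h θbar A (schedDelta δ₀ δ₁ N) fun j => 𝒞 1 j) k v cv → cv ≤ r →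
        activityNormLE (abkmNormParams L N Mord R pT r₀ h θbar A (schedDelta δ₀ δ₁ N) fun j => 𝒞 1 j) (k + 1) (Ssys h₀ k u v - Ssys h₀' k u v) (l₀ * ‖h₀ - h₀'‖ * max ‖u‖ cv))
    (hA2 : ∀ h₀ y z : HamSpace ℂ d (fieldWt h (L : ℝ) d 0) ((L : ℝ) ^ 0) (L ^ (d * 0)), ‖h₀‖ ≤ ρ → ‖h₀ + y‖ ≤ ρ → ‖h₀ + z‖ ≤ ρ → ‖h₀ + y + z‖ ≤ ρ →
      ∀ k, k < N → ∀ w : HamSpace ℂ d (fieldWt h (L : ℝ) d (k + 1)) ((L : ℝ) ^ (k + 1)) (L ^ (d * (k + 1))),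
        ‖(Asys (h₀ + y + z) k).symm w - (Asys (h₀ + y) k).symm w
          - (Asys (h₀ + z) k).symm w + (Asys h₀ k).symm w‖ ≤ a₀₀ * ‖y‖ * ‖z‖ * ‖w‖)
    (hB2 : ∀ h₀ y z : HamSpace ℂ d (fieldWt h (L : ℝ) d 0) ((L : ℝ) ^ 0) (L ^ (d * 0)), ‖h₀‖ ≤ ρ → ‖h₀ + y‖ ≤ ρ → ‖h₀ + z‖ ≤ ρ → ‖h₀ + y + z‖ ≤ ρ →
      ∀ k, k < N → ∀ (v : activitySpace (abkmNormParams L N Mord R pT r₀ h θbar A (schedDelta δ₀ δ₁ N) fun j => 𝒞 1 j) k) (cv : ℝ), activityNormLE (abkmNormParams L N Mord R pT r₀ h θbar A (schedDelta δ₀ δ₁ N) fun j => 𝒞 1 j) k v cv →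
        ‖Bsys (h₀ + y + z) k v - Bsys (h₀ + y) k v - Bsys (h₀ + z) k v + Bsys h₀ k v‖
          ≤ b₀₀ * ‖y‖ * ‖z‖ * cv)
    (hS2 : ∀ h₀ y z : HamSpace ℂ d (fieldWt h (L : ℝ) d 0) ((L : ℝ) ^ 0) (L ^ (d * 0)), ‖h₀‖ ≤ ρ → ‖h₀ + y‖ ≤ ρ → ‖h₀ + z‖ ≤ ρ → ‖h₀ + y + z‖ ≤ ρ →
      ∀ k, k < N → ∀ (u : HamSpace ℂ d (fieldWt h (L : ℝ) d k) ((L : ℝ) ^ k) (L ^ (d * k))) (v : activitySpace (abkmNormParams L N Mord R pT r₀ h θbar A (schedDelta δ₀ δ₁ N) fun j => 𝒞 1 j) k) (cv : ℝ), ‖u‖ ≤ r → activityNormLE (abkmNormParams L N Mord R pT r₀ h θbar A (schedDelta δ₀ δ₁ N) fun j => 𝒞 1 j) k v cv → cv ≤ r →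
        activityNormLE (abkmNormParams L N Mord R pT r₀ h θbar A (schedDelta δ₀ δ₁ N) fun j => 𝒞 1 j) (k + 1) (Ssys (h₀ + y + z) k u v - Ssys (h₀ + y) k u v - Ssys (h₀ + z) k u v + Ssys h₀ k u v) (l₀₀ * ‖y‖ * ‖z‖ * max ‖u‖ cv))
    (hl' : ∀ h₀ h₀' : HamSpace ℂ d (fieldWt h (L : ℝ) d 0) ((L : ℝ) ^ 0) (L ^ (d * 0)), ‖h₀‖ ≤ ρ → ‖h₀'‖ ≤ ρ → ∀ k, k < N →
      ∀ (u u' : HamSpace ℂ d (fieldWt h (L : ℝ) d k) ((L : ℝ) ^ k) (L ^ (d * k))) (v v' : activitySpace (abkmNormParams L N Mord R pT r₀ h θbar A (schedDelta δ₀ δ₁ N) fun j => 𝒞 1 j) k) (cv cv' cd : ℝ), ‖u‖ ≤ r → ‖u'‖ ≤ r →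
        activityNormLE (abkmNormParams L N Mord R pT r₀ h θbar A (schedDelta δ₀ δ₁ N) fun j => 𝒞 1 j) k v cv → cv ≤ r → activityNormLE (abkmNormParams L N Mord R pT r₀ h θbar A (schedDelta δ₀ δ₁ N) fun j => 𝒞 1 j) k v' cv' → cv' ≤ r → activityNormLE (abkmNormParams L N Mord R pT r₀ h θbar A (schedDelta δ₀ δ₁ N) fun j => 𝒞 1 j) k (v - v') cd →
        activityNormLE (abkmNormParams L N Mord R pT r₀ h θbar A (schedDelta δ₀ δ₁ N) fun j => 𝒞 1 j) (k + 1) ((Ssys h₀' k u v - Ssys h₀ k u v) - (Ssys h₀' k u' v' - Ssys h₀ k u' v')) (l₀' * ‖h₀' - h₀‖ * max ‖u - u'‖ cd))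
    (hσ2 : ∀ h₀ : HamSpace ℂ d (fieldWt h (L : ℝ) d 0) ((L : ℝ) ^ 0) (L ^ (d * 0)), ‖h₀‖ ≤ ρ → ∀ k, k < N →
      ∀ (u y z : HamSpace ℂ d (fieldWt h (L : ℝ) d k) ((L : ℝ) ^ k) (L ^ (d * k))) (v y' z' : activitySpace (abkmNormParams L N Mord R pT r₀ h θbar A (schedDelta δ₀ δ₁ N) fun j => 𝒞 1 j) k) (cv cvy cvz cvyz cy cz : ℝ),
        ‖u‖ ≤ r → ‖u + y‖ ≤ r → ‖u + z‖ ≤ r → ‖u + y + z‖ ≤ r →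
        activityNormLE (abkmNormParams L N Mord R pT r₀ h θbar A (schedDelta δ₀ δ₁ N) fun j => 𝒞 1 j) k v cv → cv ≤ r → activityNormLE (abkmNormParams L N Mord R pT r₀ h θbar A (schedDelta δ₀ δ₁ N) fun j => 𝒞 1 j) k (v + y') cvy → cvy ≤ r → activityNormLE (abkmNormParams L N Mord R pT r₀ h θbar A (schedDelta δ₀ δ₁ N) fun j => 𝒞 1 j) k (v + z') cvz → cvz ≤ r →
        activityNormLE (abkmNormParams L N Mord R pT r₀ h θbar A (schedDelta δ₀ δ₁ N) fun j => 𝒞 1 j) k (v + y' + z') cvyz → cvyz ≤ r → activityNormLE (abkmNormParams L N Mord R pT r₀ h θbar A (schedDelta δ₀ δ₁ N) fun j => 𝒞 1 j) k y' cy → activityNormLE (abkmNormParams L N Mord R pT r₀ h θbar A (schedDelta δ₀ δ₁ N) fun j => 𝒞 1 j) k z' cz →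
        activityNormLE (abkmNormParams L N Mord R pT r₀ h θbar A (schedDelta δ₀ δ₁ N) fun j => 𝒞 1 j) (k + 1) (Ssys h₀ k (u + y + z) (v + y' + z') - Ssys h₀ k (u + y) (v + y') - Ssys h₀ k (u + z) (v + z') + Ssys h₀ k u v) (σ₂ * max ‖y‖ cy * max ‖z‖ cz))
    (hΦ2 : ∀ h₀ h₀' : HamSpace ℂ d (fieldWt h (L : ℝ) d 0) ((L : ℝ) ^ 0) (L ^ (d * 0)), ‖h₀‖ ≤ ρ → ‖h₀'‖ ≤ ρ → ∀ (yN : activitySpace (abkmNormParams L N Mord R pT r₀ h θbar A (schedDelta δ₀ δ₁ N) fun j => 𝒞 1 j) N) (cv : ℝ), activityNormLE (abkmNormParams L N Mord R pT r₀ h θbar A (schedDelta δ₀ δ₁ N) fun j => 𝒞 1 j) N yN cv → cv ≤ r →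
      ‖Φ h₀ yN - Φ h₀' yN‖ ≤ lI * ‖h₀ - h₀'‖ * cv)
    (hΦ12 : ∀ h₀ h₀' : HamSpace ℂ d (fieldWt h (L : ℝ) d 0) ((L : ℝ) ^ 0) (L ^ (d * 0)), ‖h₀‖ ≤ ρ → ‖h₀'‖ ≤ ρ → ∀ (yN yN' : activitySpace (abkmNormParams L N Mord R pT r₀ h θbar A (schedDelta δ₀ δ₁ N) fun j => 𝒞 1 j) N) (cy cy' cd : ℝ),
      activityNormLE (abkmNormParams L N Mord R pT r₀ h θbar A (schedDelta δ₀ δ₁ N) fun j => 𝒞 1 j) N yN cy → cy ≤ r → activityNormLE (abkmNormParams L N Mord R pT r₀ h θbar A (schedDelta δ₀ δ₁ N) fun j => 𝒞 1 j) N yN' cy' → cy' ≤ r → activityNormLE (abkmNormParams L N Mord R pT r₀ h θbar A (schedDelta δ₀ δ₁ N) fun j => 𝒞 1 j) N (yN - yN') cd →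
      ‖(Φ h₀ yN - Φ h₀' yN) - (Φ h₀ yN' - Φ h₀' yN')‖ ≤ lI' * ‖h₀ - h₀'‖ * cd)
    (hΦ22 : ∀ h₀ y z : HamSpace ℂ d (fieldWt h (L : ℝ) d 0) ((L : ℝ) ^ 0) (L ^ (d * 0)), ‖h₀‖ ≤ ρ → ‖h₀ + y‖ ≤ ρ → ‖h₀ + z‖ ≤ ρ → ‖h₀ + y + z‖ ≤ ρ →
      ∀ (yN : activitySpace (abkmNormParams L N Mord R pT r₀ h θbar A (schedDelta δ₀ δ₁ N) fun j => 𝒞 1 j) N) (cv : ℝ), activityNormLE (abkmNormParams L N Mord R pT r₀ h θbar A (schedDelta δ₀ δ₁ N) fun j => 𝒞 1 j) N yN cv → cv ≤ r →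
      ‖Φ (h₀ + y + z) yN - Φ (h₀ + y) yN - Φ (h₀ + z) yN + Φ h₀ yN‖ ≤ lII * ‖y‖ * ‖z‖ * cv)
    (hsmallF : max (16 * Real.exp (3 / 8) * (ρ𝒦 * Real.exp (fieldWt h (L : ℝ) d 0 / (L : ℝ) ^ 0)) * A) (max (l₀ * ε / η) ((3 / 4 * b₀ + a₀ * (η + ((L : ℝ) ^ d * (pi2BoundConst d (((2 * R + 2 : ℕ) : ℝ) + ((d / 2 + 1 : ℕ) : ℝ)) * (A𝒫' * A⁻¹))) + 2 * ρ * b₀)) * ε)) ≤ (1 - κ) / 2)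
    -- four tuned seeds with their trajectories
    (x₀ : Bool → Bool → HamSpace ℂ d (fieldWt h (L : ℝ) d 0) ((L : ℝ) ^ 0) (L ^ (d * 0)))
    (x : Bool → Bool → ∀ k, HamSpace ℂ d (fieldWt h (L : ℝ) d k) ((L : ℝ) ^ k) (L ^ (d * k)))
    (htr : ∀ i j, RGFlow.IsTunedQ (E := (fun k => HamSpace ℂ d (fieldWt h (L : ℝ) d k) ((L : ℝ) ^ k) (L ^ (d * k)))) (F := (fun k => activitySpace (abkmNormParams L N Mord R pT r₀ h θbar A (schedDelta δ₀ δ₁ N) fun j => 𝒞 1 j) k)) N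
      (Asys (x₀ i j)) (Bsys (x₀ i j)) (Ssys (x₀ i j))
      (initAct (N := N) (Mord := Mord) (R := R) (p := pT) (r₀ := r₀) (θbar := θbar) (A := A) (δ₀ := δ₀)
            (δ₁ := δ₁) (𝒞 := fun j => 𝒞 1 j) (Kf i j) (x₀ i j)) (x i j))
    (htu : ∀ i j, RGFlow.InTubeQ (E := (fun k => HamSpace ℂ d (fieldWt h (L : ℝ) d k) ((L : ℝ) ^ k) (L ^ (d * k)))) (F := (fun k => activitySpace (abkmNormParams L N Mord R pT r₀ h θbar A (schedDelta δ₀ δ₁ N) fun j => 𝒞 1 j) k)) N η ε (activityNormLE (abkmNormParams L N Mord R pT r₀ h θbar A (schedDelta δ₀ δ₁ N) fun j => 𝒞 1 j))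
      (Ssys (x₀ i j))
      (initAct (N := N) (Mord := Mord) (R := R) (p := pT) (r₀ := r₀) (θbar := θbar) (A := A) (δ₀ := δ₀)
            (δ₁ := δ₁) (𝒞 := fun j => 𝒞 1 j) (Kf i j) (x₀ i j)) (x i j))
    (hx : ∀ i j, x i j 0 = x₀ i j) :
    (∀ j, ‖x₀ true j - x₀ false j‖ ≤ (2 * (Real.exp (1 / 4) * Real.exp (fieldWt h (L : ℝ) d 0 / (L : ℝ) ^ 0) * A * u₁) / (1 - κ))) ∧
    (∀ i, ‖x₀ i true - x₀ i false‖ ≤ (2 * (Real.exp (1 / 4) * Real.exp (fieldWt h (L : ℝ) d 0 / (L : ℝ) ^ 0) * A * u₂) / (1 - κ))) ∧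
    ‖x₀ true true - x₀ true false - x₀ false true + x₀ false false‖ ≤ (2 * RGFlow.secondPertSize (3 / 4) ((L : ℝ) ^ d * (pi2BoundConst d (((2 * R + 2 : ℕ) : ℝ) + ((d / 2 + 1 : ℕ) : ℝ)) * (A𝒫' * A⁻¹))) η ε σ₂ (a₀ * (2 * (Real.exp (1 / 4) * Real.exp (fieldWt h (L : ℝ) d 0 / (L : ℝ) ^ 0) * A * u₁) / (1 - κ))) (a₀ * (2 * (Real.exp (1 / 4) * Real.exp (fieldWt h (L : ℝ) d 0 / (L : ℝ) ^ 0) * A * u₂) / (1 - κ)))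
            (a₀₀ * (2 * (Real.exp (1 / 4) * Real.exp (fieldWt h (L : ℝ) d 0 / (L : ℝ) ^ 0) * A * u₁) / (1 - κ)) * (2 * (Real.exp (1 / 4) * Real.exp (fieldWt h (L : ℝ) d 0 / (L : ℝ) ^ 0) * A * u₂) / (1 - κ))) (b₀ * (2 * (Real.exp (1 / 4) * Real.exp (fieldWt h (L : ℝ) d 0 / (L : ℝ) ^ 0) * A * u₁) / (1 - κ))) (b₀ * (2 * (Real.exp (1 / 4) * Real.exp (fieldWt h (L : ℝ) d 0 / (L : ℝ) ^ 0) * A * u₂) / (1 - κ)))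
            (b₀₀ * (2 * (Real.exp (1 / 4) * Real.exp (fieldWt h (L : ℝ) d 0 / (L : ℝ) ^ 0) * A * u₁) / (1 - κ)) * (2 * (Real.exp (1 / 4) * Real.exp (fieldWt h (L : ℝ) d 0 / (L : ℝ) ^ 0) * A * u₂) / (1 - κ))) (l₀' * (2 * (Real.exp (1 / 4) * Real.exp (fieldWt h (L : ℝ) d 0 / (L : ℝ) ^ 0) * A * u₁) / (1 - κ))) (l₀' * (2 * (Real.exp (1 / 4) * Real.exp (fieldWt h (L : ℝ) d 0 / (L : ℝ) ^ 0) * A * u₂) / (1 - κ)))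
            (l₀₀ * (2 * (Real.exp (1 / 4) * Real.exp (fieldWt h (L : ℝ) d 0 / (L : ℝ) ^ 0) * A * u₁) / (1 - κ)) * (2 * (Real.exp (1 / 4) * Real.exp (fieldWt h (L : ℝ) d 0 / (L : ℝ) ^ 0) * A * u₂) / (1 - κ)))
            (((3 / 2 : ℝ) * (16 * Real.exp (3 / 8)) ^ 2 + 128 * Real.exp (1 / 4)
          + 192 * Real.exp (3 / 8) * (Real.exp (fieldWt h (L : ℝ) d 0 / (L : ℝ) ^ 0) * A)
          + 6 * (Real.exp (fieldWt h (L : ℝ) d 0 / (L : ℝ) ^ 0) * Real.exp (1 / 4) * A) ^ 2) * (u₁ + (2 * (Real.exp (1 / 4) * Real.exp (fieldWt h (L : ℝ) d 0 / (L : ℝ) ^ 0) * A * u₁) / (1 - κ))) * (u₂ + (2 * (Real.exp (1 / 4) * Real.exp (fieldWt h (L : ℝ) d 0 / (L : ℝ) ^ 0) * A * u₂) / (1 - κ)))) (2 * (Real.exp (1 / 4) * Real.exp (fieldWt h (L : ℝ) d 0 / (L : ℝ) ^ 0) * A * u₁) / (1 - κ)) (2 * (Real.exp (1 / 4) * Real.exp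 (fieldWt h (L : ℝ) d 0 / (L : ℝ) ^ 0) * A * u₂) / (1 - κ)) / (1 - κ)) ∧
    (∀ j, ‖Φ (x₀ true j) (RGFlow.fwd (Ssys (x₀ true j)) (initAct (N := N) (Mord := Mord) (R := R) (p := pT) (r₀ := r₀) (θbar := θbar) (A := A) (δ₀ := δ₀)
            (δ₁ := δ₁) (𝒞 := fun j => 𝒞 1 j) (Kf true j) (x₀ true j)) (x true j) N)
        - Φ (x₀ false j) (RGFlow.fwd (Ssys (x₀ false j)) (initAct (N := N) (Mord := Mord) (R := R) (p := pT) (r₀ := r₀) (θbar := θbar) (A := A) (δ₀ := δ₀)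
            (δ₁ := δ₁) (𝒞 := fun j => 𝒞 1 j) (Kf false j) (x₀ false j)) (x false j) N)‖
          ≤ ((A⁻¹ * A𝒫') + lI * ε) * (2 * (Real.exp (1 / 4) * Real.exp (fieldWt h (L : ℝ) d 0 / (L : ℝ) ^ 0) * A * u₁) / (1 - κ)) * η ^ N) ∧
    (∀ i, ‖Φ (x₀ i true) (RGFlow.fwd (Ssys (x₀ i true)) (initAct (N := N) (Mord := Mord) (R := R) (p := pT) (r₀ := r₀) (θbar := θbar) (A := A) (δ₀ := δ₀)
            (δ₁ := δ₁) (𝒞 := fun j => 𝒞 1 j) (Kf i true) (x₀ i true)) (x i true) N)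
        - Φ (x₀ i false) (RGFlow.fwd (Ssys (x₀ i false)) (initAct (N := N) (Mord := Mord) (R := R) (p := pT) (r₀ := r₀) (θbar := θbar) (A := A) (δ₀ := δ₀)
            (δ₁ := δ₁) (𝒞 := fun j => 𝒞 1 j) (Kf i false) (x₀ i false)) (x i false) N)‖
          ≤ ((A⁻¹ * A𝒫') + lI * ε) * (2 * (Real.exp (1 / 4) * Real.exp (fieldWt h (L : ℝ) d 0 / (L : ℝ) ^ 0) * A * u₂) / (1 - κ)) * η ^ N) ∧
    ‖Φ (x₀ true true) (RGFlow.fwd (Ssys (x₀ true true)) (initAct (N := N) (Mord := Mord) (R := R) (p := pT) (r₀ := r₀) (θbar := θbar) (A := A) (δ₀ := δ₀)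
            (δ₁ := δ₁) (𝒞 := fun j => 𝒞 1 j) (Kf true true) (x₀ true true)) (x true true) N)
        - Φ (x₀ true false) (RGFlow.fwd (Ssys (x₀ true false)) (initAct (N := N) (Mord := Mord) (R := R) (p := pT) (r₀ := r₀) (θbar := θbar) (A := A) (δ₀ := δ₀)
            (δ₁ := δ₁) (𝒞 := fun j => 𝒞 1 j) (Kf true false) (x₀ true false)) (x true false) N)
        - Φ (x₀ false true) (RGFlow.fwd (Ssys (x₀ false true)) (initAct (N := N) (Mord := Mord) (R := R) (p := pT) (r₀ := r₀) (θbar := θbar) (A := A) (δ₀ := δ₀)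
            (δ₁ := δ₁) (𝒞 := fun j => 𝒞 1 j) (Kf false true) (x₀ false true)) (x false true) N)
        + Φ (x₀ false false) (RGFlow.fwd (Ssys (x₀ false false)) (initAct (N := N) (Mord := Mord) (R := R) (p := pT) (r₀ := r₀) (θbar := θbar) (A := A) (δ₀ := δ₀)
            (δ₁ := δ₁) (𝒞 := fun j => 𝒞 1 j) (Kf false false) (x₀ false false)) (x false false) N)‖
      ≤ ((A⁻¹ * A𝒫') * (2 * RGFlow.secondPertSize (3 / 4) ((L : ℝ) ^ d * (pi2BoundConst d (((2 * R + 2 : ℕ) : ℝ) + ((d / 2 + 1 : ℕ) : ℝ)) * (A𝒫' * A⁻¹))) η ε σ₂ (a₀ * (2 * (Real.exp (1 / 4) * Real.exp (fieldWt h (L : ℝ) d 0 / (L : ℝ) ^ 0) * A * u₁) / (1 - κ))) (a₀ * (2 * (Real.exp (1 / 4) * Real.exp (fieldWt h (L : ℝ) d 0 / (L : ℝ) ^ 0) * A * u₂) / (1 - κ)))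
            (a₀₀ * (2 * (Real.exp (1 / 4) * Real.exp (fieldWt h (L : ℝ) d 0 / (L : ℝ) ^ 0) * A * u₁) / (1 - κ)) * (2 * (Real.exp (1 / 4) * Real.exp (fieldWt h (L : ℝ) d 0 / (L : ℝ) ^ 0) * A * u₂) / (1 - κ))) (b₀ * (2 * (Real.exp (1 / 4) * Real.exp (fieldWt h (L : ℝ) d 0 / (L : ℝ) ^ 0) * A * u₁) / (1 - κ))) (b₀ * (2 * (Real.exp (1 / 4) * Real.exp (fieldWt h (L : ℝ) d 0 / (L : ℝ) ^ 0) * A * u₂) / (1 - κ)))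
            (b₀₀ * (2 * (Real.exp (1 / 4) * Real.exp (fieldWt h (L : ℝ) d 0 / (L : ℝ) ^ 0) * A * u₁) / (1 - κ)) * (2 * (Real.exp (1 / 4) * Real.exp (fieldWt h (L : ℝ) d 0 / (L : ℝ) ^ 0) * A * u₂) / (1 - κ))) (l₀' * (2 * (Real.exp (1 / 4) * Real.exp (fieldWt h (L : ℝ) d 0 / (L : ℝ) ^ 0) * A * u₁) / (1 - κ))) (l₀' * (2 * (Real.exp (1 / 4) * Real.exp (fieldWt h (L : ℝ) d 0 / (L : ℝ) ^ 0) * A * u₂) / (1 - κ)))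
            (l₀₀ * (2 * (Real.exp (1 / 4) * Real.exp (fieldWt h (L : ℝ) d 0 / (L : ℝ) ^ 0) * A * u₁) / (1 - κ)) * (2 * (Real.exp (1 / 4) * Real.exp (fieldWt h (L : ℝ) d 0 / (L : ℝ) ^ 0) * A * u₂) / (1 - κ)))
            (((3 / 2 : ℝ) * (16 * Real.exp (3 / 8)) ^ 2 + 128 * Real.exp (1 / 4)
          + 192 * Real.exp (3 / 8) * (Real.exp (fieldWt h (L : ℝ) d 0 / (L : ℝ) ^ 0) * A)
          + 6 * (Real.exp (fieldWt h (L : ℝ) d 0 / (L : ℝ) ^ 0) * Real.exp (1 / 4) * A) ^ 2) * (u₁ + (2 * (Real.exp (1 / 4) * Real.exp (fieldWt h (L : ℝ) d 0 / (L : ℝ) ^ 0) * A * u₁) / (1 - κ))) * (u₂ + (2 * (Real.exp (1 / 4) * Real.exp (fieldWt h (L : ℝ) d 0 / (L : ℝ) ^ 0) * A * u₂) / (1 - κ)))) (2 * (Real.exp (1 / 4) * Real.exp (fieldWt h (L : ℝ) d 0 / (L : ℝ) ^ 0) * A * u₁) / (1 - κ)) (2 * (Real.exp (1 / 4) * Real.exp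 (fieldWt h (L : ℝ) d 0 / (L : ℝ) ^ 0) * A * u₂) / (1 - κ)) / (1 - κ))
        + 2 * lI' * (2 * (Real.exp (1 / 4) * Real.exp (fieldWt h (L : ℝ) d 0 / (L : ℝ) ^ 0) * A * u₁) / (1 - κ)) * (2 * (Real.exp (1 / 4) * Real.exp (fieldWt h (L : ℝ) d 0 / (L : ℝ) ^ 0) * A * u₂) / (1 - κ))
        + (lI * (2 * RGFlow.secondPertSize (3 / 4) ((L : ℝ) ^ d * (pi2BoundConst d (((2 * R + 2 : ℕ) : ℝ) + ((d / 2 + 1 : ℕ) : ℝ)) * (A𝒫' * A⁻¹))) η ε σ₂ (a₀ * (2 * (Real.exp (1 / 4) * Real.exp (fieldWt h (L : ℝ) d 0 / (L : ℝ) ^ 0) * A * u₁) / (1 - κ))) (a₀ * (2 * (Real.exp (1 / 4) * Real.exp (fieldWt h (L : ℝ) d 0 / (L : ℝ) ^ 0) * A * u₂) / (1 - κ)))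
            (a₀₀ * (2 * (Real.exp (1 / 4) * Real.exp (fieldWt h (L : ℝ) d 0 / (L : ℝ) ^ 0) * A * u₁) / (1 - κ)) * (2 * (Real.exp (1 / 4) * Real.exp (fieldWt h (L : ℝ) d 0 / (L : ℝ) ^ 0) * A * u₂) / (1 - κ))) (b₀ * (2 * (Real.exp (1 / 4) * Real.exp (fieldWt h (L : ℝ) d 0 / (L : ℝ) ^ 0) * A * u₁) / (1 - κ))) (b₀ * (2 * (Real.exp (1 / 4) * Real.exp (fieldWt h (L : ℝ) d 0 / (L : ℝ) ^ 0) * A * u₂) / (1 - κ)))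
            (b₀₀ * (2 * (Real.exp (1 / 4) * Real.exp (fieldWt h (L : ℝ) d 0 / (L : ℝ) ^ 0) * A * u₁) / (1 - κ)) * (2 * (Real.exp (1 / 4) * Real.exp (fieldWt h (L : ℝ) d 0 / (L : ℝ) ^ 0) * A * u₂) / (1 - κ))) (l₀' * (2 * (Real.exp (1 / 4) * Real.exp (fieldWt h (L : ℝ) d 0 / (L : ℝ) ^ 0) * A * u₁) / (1 - κ))) (l₀' * (2 * (Real.exp (1 / 4) * Real.exp (fieldWt h (L : ℝ) d 0 / (L : ℝ) ^ 0) * A * u₂) / (1 - κ)))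
            (l₀₀ * (2 * (Real.exp (1 / 4) * Real.exp (fieldWt h (L : ℝ) d 0 / (L : ℝ) ^ 0) * A * u₁) / (1 - κ)) * (2 * (Real.exp (1 / 4) * Real.exp (fieldWt h (L : ℝ) d 0 / (L : ℝ) ^ 0) * A * u₂) / (1 - κ)))
            (((3 / 2 : ℝ) * (16 * Real.exp (3 / 8)) ^ 2 + 128 * Real.exp (1 / 4)
          + 192 * Real.exp (3 / 8) * (Real.exp (fieldWt h (L : ℝ) d 0 / (L : ℝ) ^ 0) * A)
          + 6 * (Real.exp (fieldWt h (L : ℝ) d 0 / (L : ℝ) ^ 0) * Real.exp (1 / 4) * A) ^ 2) * (u₁ + (2 * (Real.exp (1 / 4) * Real.exp (fieldWt h (L : ℝ) d 0 / (L : ℝ) ^ 0) * A * u₁) / (1 - κ))) * (u₂ + (2 * (Real.exp (1 / 4) * Real.exp (fieldWt h (L : ℝ) d 0 / (L : ℝ) ^ 0) * A * u₂) / (1 - κ)))) (2 * (Real.exp (1 / 4) * Real.exp (fieldWt h (L : ℝ) d 0 / (L : ℝ) ^ 0) * A * u₁) / (1 - κ)) (2 * (Real.exp (1 / 4) * Real.exp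 (fieldWt h (L : ℝ) d 0 / (L : ℝ) ^ 0) * A * u₂) / (1 - κ)) / (1 - κ))
          + lII * (2 * (Real.exp (1 / 4) * Real.exp (fieldWt h (L : ℝ) d 0 / (L : ℝ) ^ 0) * A * u₁) / (1 - κ)) * (2 * (Real.exp (1 / 4) * Real.exp (fieldWt h (L : ℝ) d 0 / (L : ℝ) ^ 0) * A * u₂) / (1 - κ))) * ε) * η ^ N := by
  have hh : 0 < h := Fact.out
  have hd2 : 2 ≤ d := by omega
  have hA : 0 < A := by linarith
  have hρ0 : 0 ≤ ρ := by linarith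
  have hρ16 : ρ ≤ 1 / 16 := hρ64.trans (by norm_num)
  have hMo : Odd M := by rw [hM]; exact hLodd.pow
  have hA𝒫0 : 0 ≤ A𝒫' := by
    rw [← hA𝒫']
    exact zero_le_one.trans (one_le_weightIntConstRho hθbar hθ0 hθ
      (traceConst_nonneg d Mord R hlam.le (derivSum_nonneg d n _)))
  have hC87 : 0 ≤ pi2BoundConst d (((2 * R + 2 : ℕ) : ℝ) + ((d / 2 + 1 : ℕ) : ℝ)) :=
    pi2BoundConst_nonneg d (by positivity)
  have hβ : 0 ≤ ((L : ℝ) ^ d * (pi2BoundConst d (((2 * R + 2 : ℕ) : ℝ) + ((d / 2 + 1 : ℕ) : ℝ)) * (A𝒫' * A⁻¹))) := by positivity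
  have hρ𝒦 : 0 ≤ ρ𝒦 := by
    have h0 := (norm_nonneg _).trans (h𝒦b 0 (Nat.zero_le _) 0)
    exact (mul_nonneg_iff_of_pos_right (Real.exp_pos _)).1 h0
  have hm0 : 0 ≤ (16 * Real.exp (3 / 8) * (ρ𝒦 * Real.exp (fieldWt h (L : ℝ) d 0 / (L : ℝ) ^ 0)) * A) := by positivity
  have hm00 : 0 ≤ ((3 / 2 : ℝ) * (16 * Real.exp (3 / 8)) ^ 2 + 128 * Real.exp (1 / 4)
          + 192 * Real.exp (3 / 8) * (Real.exp (fieldWt h (L : ℝ) d 0 / (L : ℝ) ^ 0) * A)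
          + 6 * (Real.exp (fieldWt h (L : ℝ) d 0 / (L : ℝ) ^ 0) * Real.exp (1 / 4) * A) ^ 2) := by positivity
  have hμ₁0 : 0 ≤ (Real.exp (1 / 4) * Real.exp (fieldWt h (L : ℝ) d 0 / (L : ℝ) ^ 0) * A * u₁) := by positivity
  have hμ₂0 : 0 ≤ (Real.exp (1 / 4) * Real.exp (fieldWt h (L : ℝ) d 0 / (L : ℝ) ^ 0) * A * u₂) := by positivity
  -- the predicates
  have hPA : 0 < (abkmNormParams L N Mord R pT r₀ h θbar A (schedDelta δ₀ δ₁ N) fun j => 𝒞 1 j).A := hA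
  have hQ := isSubaddNormBound_activityNormLE (abkmNormParams L N Mord R pT r₀ h θbar A (schedDelta δ₀ δ₁ N) fun j => 𝒞 1 j) hPA
  have hQc := activityNormLE_of_forall_lt (abkmNormParams L N Mord R pT r₀ h θbar A (schedDelta δ₀ δ₁ N) fun j => 𝒞 1 j)
  have hQnn : ∀ k (yk : activitySpace (abkmNormParams L N Mord R pT r₀ h θbar A (schedDelta δ₀ δ₁ N) fun j => 𝒞 1 j) k) (c' : ℝ), activityNormLE (abkmNormParams L N Mord R pT r₀ h θbar A (schedDelta δ₀ δ₁ N) fun j => 𝒞 1 j) k yk c' → 0 ≤ c' :=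
    fun k yk c' hyk => activityNormLE_nonneg_abkm hPA hMo (k := k) (by exact hLodd.pow) hyk
  -- the initial activities (Lemma 12.2 and its second-order versions, `…InitActFamily`)
  obtain ⟨hm, hμ1, hμ2, hμ12⟩ := initActFamily_bounds (pT := pT) (r₀ := r₀) (n := n) (lam := lam) (μ := μ)
    (A𝒫 := A𝒫) hd2 hLodd hM (by omega) (by omega) hB hδ₀ hδ₁ hh hh0 hA hρ64 h𝒦 hU hV h𝒦b h𝒦Ub h𝒦Vb h𝒦UVb hUb
    hVb hu₁ hu₂ h𝒦small hpert Kf hKtt hKtf hKft hKff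
  -- Theorem 6.8 for every seed, and the `K_N`-slot of the last-scale functional
  subst hAsys hBsys hSsys hΦ
  have hT : ∀ h₀ : HamSpace ℂ d (fieldWt h (L : ℝ) d 0) ((L : ℝ) ^ 0) (L ^ (d * 0)), ‖h₀‖ ≤ ρ → RGFlow.IsRGStepQ (E := (fun k => HamSpace ℂ d (fieldWt h (L : ℝ) d k) ((L : ℝ) ^ k) (L ^ (d * k)))) (F := (fun k => activitySpace (abkmNormParams L N Mord R pT r₀ h θbar A (schedDelta δ₀ δ₁ N) fun j => 𝒞 1 j) k)) N r (3 / 4) ((L : ℝ) ^ d * (pi2BoundConst d (((2 * R + 2 : ℕ) : ℝ) + ((d / 2 + 1 : ℕ) : ℝ)) * (A𝒫' * A⁻¹)))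
      (sigmaABKM d L R A A𝒫' r) (activityNormLE (abkmNormParams L N Mord R pT r₀ h θbar A (schedDelta δ₀ δ₁ N) fun j => 𝒞 1 j))
      (rgA L h (fun j => 𝒞 ((1 : Matrix (Fin d) (Fin d) ℝ) + hamTuningMap ρ h₀) j))
      (rgBT hd hMord hMR hLodd hL hM hθbar hlam hn hn2 hnñ hc hC1 hallA hB pT r₀ hr₀ A hθ0 hθ hT₀ hKT₀ (hamTuningMap ρ h₀))
      (rgSQ (L := L) (N := N) (Mord := Mord) (R := R) (p := pT) (r₀ := r₀) (h := h) (θbar := θbar) (A := A)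
            (δ₀ := δ₀) (δ₁ := δ₁) (𝒞 := fun j => 𝒞 1 j) (fun j => 𝒞 ((1 : Matrix (Fin d) (Fin d) ℝ) + hamTuningMap ρ h₀) j)) :=
    fun h₀ _ => isRGStepQ_tunedSystem hd hMord hMR hLodd hL hR2 hM hθbar hlam hn hn2 hnñ hc hC1 hallA hB hp hpM hr₀ hδ₀
      hδ₁ hh0 hh2 hθ0 hθ hT₀ hKT₀ hA𝒫' hA1 hA𝒫A hsmall hr0 hr hv hωA hc3A hc2A hρ0 hqT₀ h₀
  have hΦ1 : ∀ h₀ : HamSpace ℂ d (fieldWt h (L : ℝ) d 0) ((L : ℝ) ^ 0) (L ^ (d * 0)), ‖h₀‖ ≤ ρ → ∀ (yN yN' : activitySpace (abkmNormParams L N Mord R pT r₀ h θbar A (schedDelta δ₀ δ₁ N) fun j => 𝒞 1 j) N) (cy cy' cd : ℝ),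
      activityNormLE (abkmNormParams L N Mord R pT r₀ h θbar A (schedDelta δ₀ δ₁ N) fun j => 𝒞 1 j) N yN cy → cy ≤ r → activityNormLE (abkmNormParams L N Mord R pT r₀ h θbar A (schedDelta δ₀ δ₁ N) fun j => 𝒞 1 j) N yN' cy' → cy' ≤ r →
      activityNormLE (abkmNormParams L N Mord R pT r₀ h θbar A (schedDelta δ₀ δ₁ N) fun j => 𝒞 1 j) N (yN - yN') cd →
      ‖(∫ φ, ((yN : activitySpace (abkmNormParams L N Mord R pT r₀ h θbar A (schedDelta δ₀ δ₁ N) fun j => 𝒞 1 j) N) : Finset (Fin d → ZMod M) → ((Fin d → ZMod M) → ℝ) → ℂ) Finset.univ φ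
            ∂(stepMeasure (𝒞 ((1 : Matrix (Fin d) (Fin d) ℝ) + hamTuningMap ρ h₀) (N + 1))))
        - (∫ φ, ((yN' : activitySpace (abkmNormParams L N Mord R pT r₀ h θbar A (schedDelta δ₀ δ₁ N) fun j => 𝒞 1 j) N) : Finset (Fin d → ZMod M) → ((Fin d → ZMod M) → ℝ) → ℂ) Finset.univ φ
            ∂(stepMeasure (𝒞 ((1 : Matrix (Fin d) (Fin d) ℝ) + hamTuningMap ρ h₀) (N + 1))))‖ ≤ (A⁻¹ * A𝒫') * cd :=
    fun h₀ _ yN yN' _ _ cd _ _ _ _ hcd => norm_lastScaleInt_sub_le hd hMord hMR hLodd hL hM hθbar hlam hn hn2 hnñ hc hC1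
      hallA hB hθ0 hθ hT₀ hKT₀ hA𝒫' hA1 hρ0 hqT₀ h₀ yN yN' hcd
  have hΦ4 : ∀ h₀ : HamSpace ℂ d (fieldWt h (L : ℝ) d 0) ((L : ℝ) ^ 0) (L ^ (d * 0)), ‖h₀‖ ≤ ρ → ∀ (y₁₁ y₁₀ y₀₁ y₀₀ : activitySpace (abkmNormParams L N Mord R pT r₀ h θbar A (schedDelta δ₀ δ₁ N) fun j => 𝒞 1 j) N)
      (c₁₁ c₁₀ c₀₁ c₀₀ cd : ℝ),
      activityNormLE (abkmNormParams L N Mord R pT r₀ h θbar A (schedDelta δ₀ δ₁ N) fun j => 𝒞 1 j) N y₁₁ c₁₁ → c₁₁ ≤ r → activityNormLE (abkmNormParams L N Mord R pT r₀ h θbar A (schedDelta δ₀ δ₁ N) fun j => 𝒞 1 j) N y₁₀ c₁₀ → c₁₀ ≤ r →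
      activityNormLE (abkmNormParams L N Mord R pT r₀ h θbar A (schedDelta δ₀ δ₁ N) fun j => 𝒞 1 j) N y₀₁ c₀₁ → c₀₁ ≤ r → activityNormLE (abkmNormParams L N Mord R pT r₀ h θbar A (schedDelta δ₀ δ₁ N) fun j => 𝒞 1 j) N y₀₀ c₀₀ → c₀₀ ≤ r →
      activityNormLE (abkmNormParams L N Mord R pT r₀ h θbar A (schedDelta δ₀ δ₁ N) fun j => 𝒞 1 j) N (y₁₁ - y₁₀ - y₀₁ + y₀₀) cd →
      ‖(∫ φ, ((y₁₁ : activitySpace (abkmNormParams L N Mord R pT r₀ h θbar A (schedDelta δ₀ δ₁ N) fun j => 𝒞 1 j) N) : Finset (Fin d → ZMod M) → ((Fin d → ZMod M) → ℝ) → ℂ) Finset.univ φ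
            ∂(stepMeasure (𝒞 ((1 : Matrix (Fin d) (Fin d) ℝ) + hamTuningMap ρ h₀) (N + 1))))
        - (∫ φ, ((y₁₀ : activitySpace (abkmNormParams L N Mord R pT r₀ h θbar A (schedDelta δ₀ δ₁ N) fun j => 𝒞 1 j) N) : Finset (Fin d → ZMod M) → ((Fin d → ZMod M) → ℝ) → ℂ) Finset.univ φ
            ∂(stepMeasure (𝒞 ((1 : Matrix (Fin d) (Fin d) ℝ) + hamTuningMap ρ h₀) (N + 1))))
        - (∫ φ, ((y₀₁ : activitySpace (abkmNormParams L N Mord R pT r₀ h θbar A (schedDelta δ₀ δ₁ N) fun j => 𝒞 1 j) N) : Finset (Fin d → ZMod M) → ((Fin d → ZMod M) → ℝ) → ℂ) Finset.univ φ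
            ∂(stepMeasure (𝒞 ((1 : Matrix (Fin d) (Fin d) ℝ) + hamTuningMap ρ h₀) (N + 1))))
        + (∫ φ, ((y₀₀ : activitySpace (abkmNormParams L N Mord R pT r₀ h θbar A (schedDelta δ₀ δ₁ N) fun j => 𝒞 1 j) N) : Finset (Fin d → ZMod M) → ((Fin d → ZMod M) → ℝ) → ℂ) Finset.univ φ
            ∂(stepMeasure (𝒞 ((1 : Matrix (Fin d) (Fin d) ℝ) + hamTuningMap ρ h₀) (N + 1))))‖ ≤ (A⁻¹ * A𝒫') * cd :=
    fun h₀ _ y₁₁ y₁₀ y₀₁ y₀₀ _ _ _ _ cd _ _ _ _ _ _ _ _ hcd => norm_lastScaleInt_secondDiff_le hd hMord hMR hLodd hL hM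
      hθbar hlam hn hn2 hnñ hc hC1 hallA hB hθ0 hθ hT₀ hKT₀ hA𝒫' hA1 hρ0 hqT₀ h₀ y₁₁ y₁₀ y₀₁ y₀₀ hcd
  exact RGFlow.freeEnergySizes_of_isTunedQ (E := (fun k => HamSpace ℂ d (fieldWt h (L : ℝ) d k) ((L : ℝ) ^ k) (L ^ (d * k)))) (F := (fun k => activitySpace (abkmNormParams L N Mord R pT r₀ h θbar A (schedDelta δ₀ δ₁ N) fun j => 𝒞 1 j) k)) (V := ℂ) (Q := activityNormLE (abkmNormParams L N Mord R pT r₀ h θbar A (schedDelta δ₀ δ₁ N) fun j => 𝒞 1 j))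
    (y₀ := fun i j h₀ => (initAct (N := N) (Mord := Mord) (R := R) (p := pT) (r₀ := r₀) (θbar := θbar) (A := A) (δ₀ := δ₀)
            (δ₁ := δ₁) (𝒞 := fun j => 𝒞 1 j) (Kf i j) h₀))
    (h := x₀) (x := x) hQ hQc hQnn hT hη hη1 (by norm_num) hβ hκ₁ hκ₂ hκ hε hεr hερ ha0 hb0 hl0 hm0 ha00 hb00 hl00
    hl0' hσ₂0 hm00 hμ₁0 hμ₂0 hu₁ hu₂ ha hb hl hA2 hB2 hS2 hl' hσ2 hm hμ1 hμ2 hμ12 hsmallF hΦ1 hΦ4 hΦ2 hΦ12 hΦ22 hlI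
    hlI' hlII htr htu hx

end Package

end Summit.HubbardSuperconductivity.HubbardSuperconductivity.Theorems.ComplexGFF

end
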